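import Mathlib
import HarnessLib
import Literature.NumberTheory.Sieve.LevelOfDistribution

/-!
# Sketch (ideator 3, round 1) — crux stmt-Parity-14092 `ElliottHalberstam`

First lemmas of the three crux idea cards of ideator 3, stated over existing declarations so that
they ELABORATE (nothing here is a proof of the crux; `sorry`-free except where marked none).

* card `uniform-type-two-core`: `TypeIFree`, `UniformTypeII`, `coreComposition` (the composition
  claim as a `Prop`), `SubproductWindow` (the real-variable combinatorics behind "θ ≥ 3/4 suffices"), PROVED:
  `subproductWindow_holds`.
* card `anatomy-transference`: `HasWindowDivisor`, `FactorableLevel`, `PrimeLikeLevel` and the PROVED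
  partition glue `primesHaveLevel_of_split`.
* card `divisor-shadow`: `DivisorLevel`, `DivisorLevelPrime`, `divisorLevelPrime_of_divisorLevel` (proved),
  `DkLevel` (the whole smooth sector) and the check `ζ^2 = σ₀`.

The crux decl is `Summit.Parity.GeneralizedHardyLittlewood.Theses.LiouvilleShiftedTables.ElliottHalberstam`
(`:= Literature.NumberTheory.Sieve.LevelOfDistribution.ElliottHalberstam`, `Iff.rfl`).
-/

namespace Summit.Parity.GeneralizedHardyLittlewood.Cruxes.ElliottHalberstam.Ideator3

open Filter Asymptotics Finset
open scoped ArithmeticFunction.sigma ArithmeticFunction.vonMangoldt Classical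

noncomputable section

/-- PUBLISHED COPY: to elaborate against `Literature` only (the route module was being rewritten while this
was filed), the crux is referred to through the Literature constant
`Literature.NumberTheory.Sieve.LevelOfDistribution.ElliottHalberstam`, which IS the route decl
`Summit.Parity.GeneralizedHardyLittlewood.Theses.LiouvilleShiftedTables.ElliottHalberstam` by `Iff.rfl`
(route file: `def ElliottHalberstam : Prop := Literature.NumberTheory.Sieve.LevelOfDistribution.ElliottHalberstam`;
the folder copy `Sketch.lean`, attached as item evidence, imports the route file and states everything
against the route decl verbatim, rc 0). -/
abbrev CruxEH : Prop := Literature.NumberTheory.Sieve.LevelOfDistribution.ElliottHalberstam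

/-! ## Card `uniform-type-two-core` -/

/-- **Type I is residue-uniform for free at every level.** If `α = α_x` is divisor-bounded and supported
on `m ≤ x^{1-θ-ε}`, then the discrepancy of `α ⋆ 1` (i.e. `n ↦ ∑_{m ∣ n} α m`) in ALL reduced classes to
ALL moduli `q ≤ x^θ` is `O(1)` per pair `(q, m)`, hence `≪ x^{1-ε} (log x)^{O_k(1)}` in total:
elementary (`#{l ≤ y : l ≡ b (q)} = y/q + O(1)`), no Kloosterman sums, no large sieve. -/
def TypeIFree (θ : ℝ) : Prop :=
  ∀ ε : ℝ, 0 < ε → ∀ A : ℝ, 0 < A → ∀ k : ℕ, ∀ α : ℝ → ℕ → ℝ,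
    (∀ᶠ x in atTop, ∀ m : ℕ, |α x m| ≤ (σ 0 m : ℝ) ^ k * Real.log x ^ k) →
    (∀ x : ℝ, ∀ m : ℕ, x ^ (1 - θ - ε) < (m : ℝ) → α x m = 0) →
    (fun x : ℝ => ∑ q ∈ Icc 1 ⌊x ^ θ⌋₊, ⨆ a : (ZMod q)ˣ,
        |Literature.NumberTheory.Sieve.apDiscrepancy (fun n : ℕ => ∑ m ∈ n.divisors, α x m) ⌊x⌋₊ q a|)
      =O[atTop] fun x : ℝ => x / Real.log x ^ A

/-- **Uniform Type II in the window `[x^{1-θ-ε}, x^{θ+ε}]`** (the residue-uniform bilinear statement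
`GEH[θ]` of Polymath 8b, Claim 2.6 — tree `Literature.NumberTheory.Sieve.GeneralizedElliottHalberstam` —
RESTRICTED to the scales that the Heath-Brown identity actually needs at level `θ ≥ 3/4`): for
`NM ≍ x`, `x^{1-θ-ε} ≤ M ≤ x^{θ+ε}`, `α` at scale `N` divisor-bounded, `β` at scale `M` divisor-bounded
and Siegel–Walfisz, `∑_{q ≤ x^θ} sup_{(a,q)=1} |Δ(α ⋆ β; a (q))| ≪ x (log x)^{-A}`.
Known: `θ < 1/2` (Motohashi / BFI Theorem 0, tree `BombieriFriedlanderIwaniecTheorem0b_holds` shape);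
OPEN for every `θ > 1/2` (`Literature.Barriers.Parity.LargeSieveLevelHalf`). -/
def UniformTypeII (θ : ℝ) : Prop :=
  ∀ ε : ℝ, 0 < ε → ∀ A : ℝ, 0 < A → ∀ k : ℕ, ∀ K : ℝ, 1 ≤ K → ∀ N M : ℝ → ℝ,
    ∀ α β : ℝ → ArithmeticFunction ℝ,
    (∀ᶠ x in atTop, x ^ (1 - θ - ε) ≤ M x ∧ M x ≤ x ^ (θ + ε)) →
    (∃ C : ℝ, 1 ≤ C ∧ ∀ᶠ x in atTop, x / C ≤ N x * M x ∧ N x * M x ≤ C * x) →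
    (∀ x, ∀ n : ℕ, (n : ℝ) < N x ∨ K * N x < n → α x n = 0) →
    (∀ x, ∀ n : ℕ, (n : ℝ) < M x ∨ K * M x < n → β x n = 0) →
    (∀ᶠ x in atTop, ∀ n : ℕ, |α x n| ≤ (σ 0 n : ℝ) ^ k * Real.log x ^ k ∧
      |β x n| ≤ (σ 0 n : ℝ) ^ k * Real.log x ^ k) →
    (∀ B : ℝ, 0 < B → ∃ C : ℝ, ∀ᶠ x in atTop, ∀ q r : ℕ, 1 ≤ q → 1 ≤ r → ∀ a : (ZMod q)ˣ,
      |Literature.NumberTheory.Sieve.apDiscrepancy (fun n => if n.Coprime r then β x n else 0)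
          ⌊K * M x⌋₊ q a| ≤ C * (σ 0 (q * r) : ℝ) ^ k * M x / Real.log x ^ B) →
    (fun x : ℝ => ∑ q ∈ Icc 1 ⌊x ^ θ⌋₊, ⨆ a : (ZMod q)ˣ,
        |Literature.NumberTheory.Sieve.apDiscrepancy (fun n => (α x * β x) n)
          ⌊K * K * (N x * M x)⌋₊ q a|) =O[atTop] fun x : ℝ => x / Real.log x ^ A

/-- The real-variable combinatorics behind "the window `[1-θ, 1/2]` suffices once `θ ≥ 3/4`": if
exponents `v i ∈ [0, θ]` (all variables shorter than `x^θ`, else Type I is free) sum to `1`, then some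
sub-sum lies in `[1-θ, 1/2]`. (Greedy: partial sums grow by steps `≤ θ`; if a variable is `≥ 1/2` its
complement is `≤ 1/2` and `≥ 1-θ`; otherwise all steps are `< 1/2` and the first partial sum `≥ 1-θ` is
`< 1-θ+1/2`; if it exceeds `1/2` its complement lies in `(θ - 1/2… )`, fine when `θ ≥ 3/4`.) PROVED
below (`subproductWindow_holds`). -/
def SubproductWindow : Prop :=
  ∀ θ : ℝ, 3 / 4 ≤ θ → θ < 1 → ∀ n : ℕ, ∀ v : Fin n → ℝ,
    (∀ i, 0 ≤ v i ∧ v i ≤ θ) → ∑ i, v i = 1 →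
      ∃ S : Finset (Fin n), 1 - θ ≤ ∑ i ∈ S, v i ∧ ∑ i ∈ S, v i ≤ 1 / 2

/-- Partial sums of `v : Fin n → ℝ` over indices `< j` (for `subproductWindow_holds`). -/
def windowP {n : ℕ} (v : Fin n → ℝ) (j : ℕ) : ℝ := ∑ i ∈ univ.filter (fun i : Fin n => (i : ℕ) < j), v i

theorem windowP_zero {n : ℕ} (v : Fin n → ℝ) : windowP v 0 = 0 := by
  simp [windowP]

theorem windowP_n {n : ℕ} (v : Fin n → ℝ) : windowP v n = ∑ i, v i := by
  unfold windowP
  congr 1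
  ext i
  simp

theorem windowP_succ {n : ℕ} (v : Fin n → ℝ) {j : ℕ} (hj : j < n) :
    windowP v (j + 1) = windowP v j + v ⟨j, hj⟩ := by
  unfold windowP
  have hfilt : univ.filter (fun i : Fin n => (i : ℕ) < j + 1) =
      insert (⟨j, hj⟩ : Fin n) (univ.filter (fun i : Fin n => (i : ℕ) < j)) := by
    ext i
    simp only [mem_filter, mem_univ, true_and, mem_insert, Fin.ext_iff]
    omega
  rw [hfilt, sum_insert (by simp), add_comm]

theorem windowP_compl {n : ℕ} (v : Fin n → ℝ) (j : ℕ) :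
    ∑ i ∈ univ.filter (fun i : Fin n => ¬ (i : ℕ) < j), v i = (∑ i, v i) - windowP v j := by
  have h := sum_filter_add_sum_filter_not (univ : Finset (Fin n)) (fun i : Fin n => (i : ℕ) < j) v
  unfold windowP
  linarith

/-- **`SubproductWindow` PROVED**: either some exponent is `≥ 1/2` (take its complement), or walk the
partial sums to the first one `≥ 1 - θ`; it is `< 1 - θ + 1/2`, and if it exceeds `1/2` its complement
lies in `[θ - 1/2, 1/2] ⊆ [1 - θ, 1/2]` because `θ ≥ 3/4`. -/
theorem subproductWindow_holds : SubproductWindow := by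
  intro θ hθ hθ1 n v hv hsum
  by_cases hbig : ∃ i, 1 / 2 ≤ v i
  · obtain ⟨i, hi⟩ := hbig
    refine ⟨univ.erase i, ?_, ?_⟩
    · have h := sum_erase_add (univ : Finset (Fin n)) v (mem_univ i)
      have := (hv i).2
      linarith
    · have h := sum_erase_add (univ : Finset (Fin n)) v (mem_univ i)
      linarith
  · push Not at hbig
    have hex : ∃ j, 1 - θ ≤ windowP v j := ⟨n, by rw [windowP_n, hsum]; linarith⟩
    set j₀ := Nat.find hex with hj₀
    have hj₀P : 1 - θ ≤ windowP v j₀ := Nat.find_spec hex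
    have hj₀pos : 0 < j₀ := by
      rcases Nat.eq_zero_or_pos j₀ with h | h
      · exfalso
        rw [h, windowP_zero] at hj₀P
        linarith
      · exact h
    have hj₀le : j₀ ≤ n := Nat.find_min' hex (by rw [windowP_n, hsum]; linarith)
    have hprev : windowP v (j₀ - 1) < 1 - θ := by
      have := Nat.find_min hex (show j₀ - 1 < j₀ by omega)
      push Not at this
      exact this
    have hlt : j₀ - 1 < n := by omega
    have hstep : windowP v j₀ = windowP v (j₀ - 1) + v ⟨j₀ - 1, hlt⟩ := by
      have := windowP_succ v hlt
      rw [show j₀ - 1 + 1 = j₀ by omega] at this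
      exact this
    have hPlt : windowP v j₀ < 1 - θ + 1 / 2 := by
      rw [hstep]
      have := hbig ⟨j₀ - 1, hlt⟩
      linarith
    by_cases hhalf : windowP v j₀ ≤ 1 / 2
    · exact ⟨univ.filter (fun i : Fin n => (i : ℕ) < j₀), hj₀P, hhalf⟩
    · push Not at hhalf
      refine ⟨univ.filter (fun i : Fin n => ¬ (i : ℕ) < j₀), ?_, ?_⟩
      · rw [windowP_compl, hsum]
        linarith
      · rw [windowP_compl, hsum]
        linarith

/-- **Composition claim of card `uniform-type-two-core`** (a `Prop`, to become the kernel-checked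
`ElliottHalberstam_of` of a crux-plan skeleton): Heath-Brown's identity (tree:
`Literature.NumberTheory.Sieve.HeathBrown.heathBrown_identity`), `TypeIFree` (provable), finer-than-dyadic
decomposition and `SubproductWindow` reduce `PrimesHaveLevel θ` for `θ ∈ [3/4, 1)` to `UniformTypeII θ`;
monotonicity (`PrimesHaveLevel.mono`) gives all `θ < 1`. This is Polymath 8b Prop. 2.7 (`GEH[θ] ⟹ EH[θ]`)
with the hypothesis cut down to the window. -/
def coreComposition : Prop :=
  (∀ θ : ℝ, 3 / 4 ≤ θ → θ < 1 → UniformTypeII θ) → CruxEH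

/-! ## Card `anatomy-transference` -/

/-- `q` has a divisor in the window `[x^η, x^{2η}]` ("conveniently sized factor", Maynard 2020/25 I–III). -/
def HasWindowDivisor (x η : ℝ) (q : ℕ) : Prop :=
  ∃ d ∈ q.divisors, x ^ η ≤ (d : ℝ) ∧ (d : ℝ) ≤ x ^ (2 * η)

/-- Level `θ` (Bombieri–Vinogradov shape, `sup_y sup_a`, tree `primeAPError`) restricted to moduli WITH
a divisor in `[x^η, x^{2η}]`. Known beyond `1/2` only at `θ = 1/2 + δ` with `η ≈ 1/10` and either a weak
error term `δ π(x)` (Maynard III, Thm 1.1) or an "almost uniform" sup (Thm 1.2). [arXiv:2006.08250] -/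
def FactorableLevel (θ η : ℝ) : Prop :=
  ∀ A : ℝ, 0 < A → ∀ ε : ℝ, 0 < ε →
    (fun x : ℝ => ∑ q ∈ (Icc 1 ⌊x ^ (θ - ε)⌋₊).filter (fun q => HasWindowDivisor x η q),
        Literature.NumberTheory.Sieve.primeAPError x q) =O[atTop] fun x : ℝ => x / Real.log x ^ A

/-- The complementary "prime-like" moduli (no divisor in the window: `q = s · p₁ ⋯ p_j` with `s < x^η`
and every `p_i > x^{2η}`; at `θ` close to `1/2 + η` these are the primes and near-primes). NOTHING
residue-uniform is known here beyond `θ < 1/2`. -/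
def PrimeLikeLevel (θ η : ℝ) : Prop :=
  ∀ A : ℝ, 0 < A → ∀ ε : ℝ, 0 < ε →
    (fun x : ℝ => ∑ q ∈ (Icc 1 ⌊x ^ (θ - ε)⌋₊).filter (fun q => ¬ HasWindowDivisor x η q),
        Literature.NumberTheory.Sieve.primeAPError x q) =O[atTop] fun x : ℝ => x / Real.log x ^ A

/-- PROVED partition glue: the two halves give the level (sum over a filter plus its complement). -/
theorem primesHaveLevel_of_split {θ η : ℝ} (h₁ : FactorableLevel θ η) (h₂ : PrimeLikeLevel θ η) :
    Literature.NumberTheory.Sieve.PrimesHaveLevel θ := by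
  intro A hA ε hε
  have h := (h₁ A hA ε hε).add (h₂ A hA ε hε)
  exact h.congr_left fun x => Finset.sum_filter_add_sum_filter_not _ _ _

/-- Hence the anatomy composition to the crux: both halves at every `θ < 1` (for one `η = η(θ) > 0`). -/
theorem elliottHalberstam_of_split
    (h : ∀ θ : ℝ, θ < 1 → ∃ η : ℝ, 0 < η ∧ FactorableLevel θ η ∧ PrimeLikeLevel θ η) :
    CruxEH := by
  intro θ hθ
  obtain ⟨η, -, h₁, h₂⟩ := h θ hθ
  exact primesHaveLevel_of_split h₁ h₂

/-! ## Card `divisor-shadow` -/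

/-- **Divisor level with sup over residues, all moduli**: `∑_{q ≤ x^{θ-ε}} sup_{(a,q)=1} |Δ(d₂ ; a (q))|
≪ x (log x)^{-A}` with Polymath's discrepancy (tree `apDiscrepancy`; the main term
`φ(q)^{-1} ∑_{(n,q)=1} d(n)` is the right one because the leading term of `∑_{n ≡ a (q)} d(n)` does not
depend on the reduced class `a`). Known for `θ < 2/3` (Selberg, Hooley, Heath-Brown 1979: pointwise
`Δ ≪ q^{1/2+ε} + x^{1/3+ε}` by Weil's bound, uniform in `a`); OPEN beyond `2/3` with the sup (beyond 2/3
is known only for smooth moduli — Irving 2015 — and prime-power moduli — Khan 2016, Zhong–Zhang 2025 —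
or with a FIXED residue on average over moduli — Fouvry 1985 — or in `ℓ²` over residues — Blomer 2008,
Rodgers–Soundararajan 2018). -/
def DivisorLevel (θ : ℝ) : Prop :=
  ∀ A : ℝ, 0 < A → ∀ ε : ℝ, 0 < ε →
    (fun x : ℝ => ∑ q ∈ Icc 1 ⌊x ^ (θ - ε)⌋₊, ⨆ a : (ZMod q)ˣ,
        |Literature.NumberTheory.Sieve.apDiscrepancy (fun n : ℕ => (σ 0 n : ℝ)) ⌊x⌋₊ q a|)
      =O[atTop] fun x : ℝ => x / Real.log x ^ A

/-- The same at PRIME moduli only — the first place where residue-uniformity costs anything beyond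
`x^{2/3}`: by Voronoi, `Δ(d₂; a (p)) = p^{-2} ∑_{h ≤ p²/x} d(h) W̃(h) S(a, h; p)`, so `DivisorLevelPrime θ` for
`θ > 2/3` asks for cancellation in sums of Kloosterman sums of length `p^{2-1/θ} ∈ (p^{1/2}, p)` below the
Pólya–Vinogradov range, uniformly in `a`. -/
def DivisorLevelPrime (θ : ℝ) : Prop :=
  ∀ A : ℝ, 0 < A → ∀ ε : ℝ, 0 < ε →
    (fun x : ℝ => ∑ q ∈ (Icc 1 ⌊x ^ (θ - ε)⌋₊).filter Nat.Prime, ⨆ a : (ZMod q)ˣ,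
        |Literature.NumberTheory.Sieve.apDiscrepancy (fun n : ℕ => (σ 0 n : ℝ)) ⌊x⌋₊ q a|)
      =O[atTop] fun x : ℝ => x / Real.log x ^ A

/-- `DivisorLevel θ → DivisorLevelPrime θ` (sub-sum of nonnegative terms) — PROVED. -/
theorem divisorLevelPrime_of_divisorLevel {θ : ℝ} (h : DivisorLevel θ) : DivisorLevelPrime θ := by
  intro A hA ε hε
  refine IsBigO.trans (IsBigO.of_bound 1 ?_) (h A hA ε hε)
  filter_upwards with x
  have h0 : ∀ q : ℕ, 0 ≤ ⨆ a : (ZMod q)ˣ,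
      |Literature.NumberTheory.Sieve.apDiscrepancy (fun n : ℕ => (σ 0 n : ℝ)) ⌊x⌋₊ q a| :=
    fun q => Real.iSup_nonneg fun _ => abs_nonneg _
  rw [one_mul, Real.norm_eq_abs, Real.norm_eq_abs,
    abs_of_nonneg (Finset.sum_nonneg fun q _ => h0 q), abs_of_nonneg (Finset.sum_nonneg fun q _ => h0 q)]
  exact Finset.sum_le_sum_of_subset_of_nonneg (Finset.filter_subset _ _) fun q _ _ => h0 q

/-- The whole SMOOTH sector: `d_k` (coefficients of `ζ^k`, Mathlib `ArithmeticFunction.zeta ^ k`) in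
progressions with the sup over reduced residues, all moduli `q ≤ x^{θ-ε}`. `k = 2` is `DivisorLevel`
(up to the cast); `k = 3` is known to level `1/2 + 1/46` at prime moduli (Fouvry–Kowalski–Michel 2015) and
`1/2 + 1/82` in general (Heath-Brown 1986); `k ≥ 4` only to level `1/2` — four smooth factors of length
`x^{1/4}` are exactly the terms Maynard III cannot handle uniformly. -/
def DkLevel (k : ℕ) (θ : ℝ) : Prop :=
  ∀ A : ℝ, 0 < A → ∀ ε : ℝ, 0 < ε →
    (fun x : ℝ => ∑ q ∈ Icc 1 ⌊x ^ (θ - ε)⌋₊, ⨆ a : (ZMod q)ˣ,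
        |Literature.NumberTheory.Sieve.apDiscrepancy
          (fun n : ℕ => (((ArithmeticFunction.zeta : ArithmeticFunction ℕ) ^ k) n : ℝ)) ⌊x⌋₊ q a|)
      =O[atTop] fun x : ℝ => x / Real.log x ^ A

/-- `d_2 = ζ^2` pointwise (sanity check that `DkLevel 2` is `DivisorLevel`): `(ζ * ζ) n = σ₀ n`. -/
example (n : ℕ) : ((ArithmeticFunction.zeta : ArithmeticFunction ℕ) ^ 2) n = σ 0 n := by
  rw [pow_two, ← ArithmeticFunction.zeta_mul_pow_eq_sigma, ArithmeticFunction.pow_zero_eq_zeta]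

end

end Summit.Parity.GeneralizedHardyLittlewood.Cruxes.ElliottHalberstam.Ideator3
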